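import Summits.ResolutionOfSingularities.ResolutionOfSingularities.Theorems.WeightedInvariantIota3RowBSharpEngine

/-!
# (F-3g) Row B, ALL SUB-FACE MIXED TERMS — tails and the dominance theorem  [OURS · L1 W4.3]

Kernel infrastructure for RE-ENTRY OBJECT #1 of chain w43 (door crux `stmt-ResolutionOfSingularities-19897`),
rung (F-3g): for `f = y^p + Λ v^d + Σ_j γ_j x^{c_j} v^{b_j} + x^M` with face terms `q c_j + r₂ b_j = N`,
`1 ≤ b_j < d`, and `p ∣ c_j` required ONLY for `b_j = d − 1`, every competing two-flag is dominated
(`rowB_secondMember_mem_of_isTwoFlag`).  Uses the sharp engine `RowA.rowB_core_anyFrame'`.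

[OURS · L1 W4.3] NOT a statement of the manuscript; AI-produced, gate-checked, weaker than expert review.
-/

set_option linter.dupNamespace false

namespace Summit.ResolutionOfSingularities.ResolutionOfSingularities.Theorems.LocalEngine.Iota3.RowA

open MvPowerSeries IsLocalRing
open Summit.ResolutionOfSingularities.ResolutionOfSingularities.Theorems.LocalEngine.Iota3.PClass
open Summit.ResolutionOfSingularities.ResolutionOfSingularities.Cruxes.HypersurfaceCentreConstruction.LocalEngine.Iota3
open Literature.AlgebraicGeometry.Resolution.FormalCoordChange

variable {K : Type*} [Field K] {ι : Type*}

/-! ## The three hypotheses for sub-face tails -/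

/-- (Frobenius hypothesis) a class-`0` face tail has no coefficient at the exponents `p·e_i`. -/
theorem coeff_faceTail_nsmul_single (p : ℕ) {d q r₁ r₂ N : ℕ} (hN₁ : p * r₁ = N) (hq1 : q < r₁) (hr : r₂ < r₁)
    (J : Finset ι) (γ : ι → K) (c b : ι → ℕ)
    (hJ : ∀ j ∈ J, 1 ≤ b j ∧ b j < d ∧ q * c j + r₂ * b j = N ∧ (b j + 1 = d → p ∣ c j))
    {x v : MvPowerSeries (Fin 3) K} (hx0 : constantCoeff x = 0) (hv0 : constantCoeff v = 0) (i : Fin 3) :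
    coeff (p • Finsupp.single i 1) (∑ j ∈ J, C (γ j) * (x ^ c j * v ^ b j)) = 0 := by
  rw [map_sum]
  refine Finset.sum_eq_zero fun j hj => ?_
  obtain ⟨hb, -, hface, -⟩ := hJ j hj
  rw [coeff_C_mul, coeff_of_lt_order, mul_zero]
  refine lt_of_lt_of_le ?_ le_order_mul
  refine lt_of_lt_of_le ?_ (add_le_add (le_order_pow_of_constantCoeff_eq_zero (c j) hx0)
    (le_order_pow_of_constantCoeff_eq_zero (b j) hv0))
  rw [degree_nsmul_single]
  exact_mod_cast lt_add_of_face hN₁ hq1 hr hb hface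

/-- (Hypothesis (α)) a class-`0` face tail weighs more than `d·a` when `W(v) = a < r₂`. -/
theorem lt_weightedOrder_faceTail {p d q r₁ r₂ N : ℕ} (hqr : q < r₂) (hr : r₂ ≤ r₁) (hN₂ : d * r₂ = N)
    (J : Finset ι) (γ : ι → K) (c b : ι → ℕ)
    (hJ : ∀ j ∈ J, 1 ≤ b j ∧ b j < d ∧ q * c j + r₂ * b j = N ∧ (b j + 1 = d → p ∣ c j))
    {x v : MvPowerSeries (Fin 3) K} (hx0 : constantCoeff x = 0) (a : ℕ)
    (hWv : v.weightedOrder ![q, r₂, r₁] = (a : ℕ∞)) (ha : a < r₂) :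
    (((d * a : ℕ)) : ℕ∞) < (∑ j ∈ J, C (γ j) * (x ^ c j * v ^ b j)).weightedOrder ![q, r₂, r₁] := by
  have hle : (((d * a + 1 : ℕ)) : ℕ∞) ≤ (∑ j ∈ J, C (γ j) * (x ^ c j * v ^ b j)).weightedOrder ![q, r₂, r₁] := by
    refine nat_le_weightedOrder _ fun e he => ?_
    rw [map_sum]
    refine Finset.sum_eq_zero fun j hj => ?_
    obtain ⟨-, hbd, hface, -⟩ := hJ j hj
    rw [coeff_C_mul, coeff_eq_zero_of_lt_weightedOrder (![q, r₂, r₁]), mul_zero]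
    refine lt_of_lt_of_le ?_ (le_weightedOrder_pow_mul hqr.le hr hx0 (c j) (v ^ b j))
    have hvb : (((b j * a : ℕ)) : ℕ∞) ≤ (v ^ b j).weightedOrder ![q, r₂, r₁] := by
      refine le_trans ?_ (le_weightedOrder_pow _ (b j))
      rw [hWv, nsmul_eq_mul, Nat.cast_mul]
    refine lt_of_lt_of_le ?_ (add_le_add le_rfl hvb)
    have hnum : d * a < c j * q + b j * a := by
      obtain ⟨δ, hδ⟩ := Nat.exists_eq_add_of_lt hbd
      obtain ⟨ε, hε⟩ := Nat.exists_eq_add_of_lt ha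
      subst hδ; subst hε
      nlinarith
    exact_mod_cast lt_of_lt_of_le he (Nat.succ_le_of_lt hnum)
  exact lt_of_lt_of_le (by exact_mod_cast Nat.lt_succ_self _) hle

/-- (Hypothesis (β), sharp form) in the contradiction branch `W(v_0) = a < ρ = W(v − v_0) ≤ r₂` the non-class-`0` part
of a face tail weighs more than `(d−1)a + ρ`: terms with `b ≤ d − 2` by their plain weight `q c + b a`, the
`b = d − 1` terms (where `p ∣ c`) through `x^c (v^b − (v^b)_0)`. -/
theorem lt_weightedOrder_faceTail_sub_pClassComponent (p : ℕ) [Fact p.Prime] [CharP K p] {d q r₁ r₂ N : ℕ}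
    (hqr : q < r₂) (hr : r₂ ≤ r₁) (hN₂ : d * r₂ = N) (J : Finset ι) (γ : ι → K) (c b : ι → ℕ)
    (hJ : ∀ j ∈ J, 1 ≤ b j ∧ b j < d ∧ q * c j + r₂ * b j = N ∧ (b j + 1 = d → p ∣ c j))
    {x v : MvPowerSeries (Fin 3) K} (hx0 : constantCoeff x = 0) (a ρ : ℕ)
    (hWG : (pClassComponent p 0 v).weightedOrder ![q, r₂, r₁] = (a : ℕ∞))
    (hWR : (v - pClassComponent p 0 v).weightedOrder ![q, r₂, r₁] = (ρ : ℕ∞)) (ha : a < r₂) (haρ : a < ρ)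
    (hρ : ρ ≤ r₂) :
    ((((d - 1) * a + ρ : ℕ)) : ℕ∞) <
      (∑ j ∈ J, C (γ j) * (x ^ c j * v ^ b j) -
        pClassComponent p 0 (∑ j ∈ J, C (γ j) * (x ^ c j * v ^ b j))).weightedOrder ![q, r₂, r₁] := by
  haveI : NeZero p := ⟨(Fact.out : p.Prime).ne_zero⟩
  have hdiff : ∑ j ∈ J, C (γ j) * (x ^ c j * v ^ b j) - pClassComponent p 0 (∑ j ∈ J, C (γ j) * (x ^ c j * v ^ b j)) =
      ∑ j ∈ J, C (γ j) * (x ^ c j * v ^ b j - pClassComponent p 0 (x ^ c j * v ^ b j)) := by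
    rw [pClassComponent_sum, ← Finset.sum_sub_distrib]
    refine Finset.sum_congr rfl fun j _ => ?_
    rw [pClassComponent_C_mul, mul_sub]
  have hGR : (pClassComponent p 0 v).weightedOrder ![q, r₂, r₁] ≤ (v - pClassComponent p 0 v).weightedOrder ![q, r₂, r₁] := by
    rw [hWG, hWR, Nat.cast_le]; exact haρ.le
  have hWv : (a : ℕ∞) ≤ v.weightedOrder ![q, r₂, r₁] := by
    have h := min_weightedOrder_le_add (w := ![q, r₂, r₁]) (f := v - pClassComponent p 0 v) (g := pClassComponent p 0 v)
    rw [sub_add_cancel, hWG, hWR] at h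
    exact le_trans (le_min (by exact_mod_cast haρ.le) le_rfl) h
  rw [hdiff]
  have hle : ((((d - 1) * a + ρ + 1 : ℕ)) : ℕ∞) ≤
      (∑ j ∈ J, C (γ j) * (x ^ c j * v ^ b j - pClassComponent p 0 (x ^ c j * v ^ b j))).weightedOrder ![q, r₂, r₁] := by
    refine nat_le_weightedOrder _ fun e he => ?_
    rw [map_sum]
    refine Finset.sum_eq_zero fun j hj => ?_
    obtain ⟨hb1, hbd, hface, hlast⟩ := hJ j hj
    rw [coeff_C_mul, coeff_eq_zero_of_lt_weightedOrder (![q, r₂, r₁]), mul_zero]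
    by_cases hpc : p ∣ c j
    · -- class-`0` transversal power: `x^c (v^b − (v^b)_0)`
      obtain ⟨m, hm⟩ := hpc
      have hxc : pClassComponent p 0 (x ^ c j) = x ^ c j := by rw [hm]; exact pClassComponent_zero_pow_mul p x m
      rw [pClassComponent_mul_of_left_pure_zero hxc, ← mul_sub]
      refine lt_of_lt_of_le ?_ (le_weightedOrder_pow_mul hqr.le hr hx0 (c j) _)
      have hvb : ((((b j - 1) * a + ρ : ℕ)) : ℕ∞) ≤ (v ^ b j - pClassComponent p 0 (v ^ b j)).weightedOrder ![q, r₂, r₁] := by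
        refine le_trans ?_ (le_weightedOrder_pow_sub_pClassComponent p _ v hb1 hGR)
        rw [hWG, hWR, nsmul_eq_mul]
        push_cast [Nat.cast_sub hb1]
        exact le_rfl
      refine lt_of_lt_of_le ?_ (add_le_add le_rfl hvb)
      have hnum : (d - 1) * a + ρ < c j * q + ((b j - 1) * a + ρ) := by
        obtain ⟨δ, hδ⟩ := Nat.exists_eq_add_of_lt hbd
        obtain ⟨ε, hε⟩ := Nat.exists_eq_add_of_lt ha
        subst hδ; subst hε
        have h1 : b j + δ + 1 - 1 = (b j - 1) + (δ + 1) := by omega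
        have h2 : (b j - 1) + 1 = b j := Nat.sub_add_cancel hb1
        rw [h1]
        nlinarith [mul_lt_mul_of_pos_left ha (Nat.succ_pos δ), hface, h2]
      exact_mod_cast lt_of_lt_of_le he (Nat.succ_le_of_lt hnum)
    · -- `b ≤ d − 2`: the plain weight `q c + b a` suffices since `ρ ≤ r₂`
      have hbd2 : b j + 2 ≤ d := by
        rcases Nat.lt_or_ge (b j + 1) d with h | h
        · omega
        · exact absurd (hlast (le_antisymm (by omega) h)) hpc
      refine lt_of_lt_of_le ?_ (le_weightedOrder_sub_pClassComponent _ p 0 _)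
      refine lt_of_lt_of_le ?_ (le_weightedOrder_pow_mul hqr.le hr hx0 (c j) _)
      have hvb : (((b j * a : ℕ)) : ℕ∞) ≤ (v ^ b j).weightedOrder ![q, r₂, r₁] := by
        refine le_trans ?_ (le_weightedOrder_pow _ (b j))
        rw [Nat.cast_mul, nsmul_eq_mul]
        gcongr
      refine lt_of_lt_of_le ?_ (add_le_add le_rfl hvb)
      have hnum : (d - 1) * a + ρ < c j * q + b j * a := by
        obtain ⟨δ, hδ⟩ := Nat.exists_eq_add_of_le hbd2
        obtain ⟨ε, hε⟩ := Nat.exists_eq_add_of_lt ha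
        subst hδ; subst hε
        rw [show b j + 2 + δ - 1 = b j + 1 + δ by omega]
        nlinarith [hface, hρ]
      exact_mod_cast lt_of_lt_of_le he (Nat.succ_le_of_lt hnum)
  exact lt_of_lt_of_le (by exact_mod_cast Nat.lt_succ_self _) hle

/-! ## Row B (all sub-face tails) in an arbitrary frame and against every flag -/

/-- **ROW B, ALL SUB-FACE TAILS, ARBITRARY FRAME**: for any frame `(x, v, y)` of `K⟦X₀,X₁,X₂⟧`,
`y^p + Λ v^d + Σ_j γ_j x^{c_j} v^{b_j} + x^M ∈ F_{(X₂;X₁)}(N) ⇒ v ∈ F_{(X₂;X₁)}(r₂)`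
(`1 ≤ b_j < d`, `q c_j + r₂ b_j = N`, and `p ∣ c_j` whenever `b_j = d − 1`). -/
theorem rowB_secondMember_mem_anyFrame (p : ℕ) [Fact p.Prime] [CharP K p] (d M q r₁ r₂ N : ℕ)
    (hpd : ¬ p ∣ d) (hlt : p < d) (hN₁ : p * r₁ = N) (hN₂ : d * r₂ = N) (hN₃ : M * q = N) (hq : 0 < q)
    (hqr : q < r₂) (Λ : K) (hΛ : Λ ≠ 0) (J : Finset ι) (γ : ι → K) (c b : ι → ℕ)
    (hJ : ∀ j ∈ J, 1 ≤ b j ∧ b j < d ∧ q * c j + r₂ * b j = N ∧ (b j + 1 = d → p ∣ c j)) (x y v : MvPowerSeries (Fin 3) K)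
    (hframe : Ideal.span {x, v, y} = maximalIdeal (MvPowerSeries (Fin 3) K))
    (hreach : y ^ p + C Λ * v ^ d + (∑ j ∈ J, C (γ j) * (x ^ c j * v ^ b j)) + x ^ M ∈
      flagContactFiltration (X 2 : MvPowerSeries (Fin 3) K) (X 1) q r₁ r₂ N) :
    v ∈ flagContactFiltration (X 2 : MvPowerSeries (Fin 3) K) (X 1) q r₁ r₂ r₂ := by
  have hp : p.Prime := Fact.out
  have hr₂ : 0 < r₂ := by omega
  have hr₂r₁ : r₂ < r₁ := by
    by_contra h
    push Not at h
    have h1 : p * r₁ ≤ p * r₂ := Nat.mul_le_mul_left _ h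
    have h2 : p * r₂ < d * r₂ := Nat.mul_lt_mul_of_pos_right hlt hr₂
    omega
  have hadm : AdmissibleTriple q r₁ r₂ := ⟨hq, hqr.le, hr₂r₁.le⟩
  have hmem : ∀ g ∈ ({x, v, y} : Set (MvPowerSeries (Fin 3) K)), constantCoeff g = 0 := fun g hg =>
    constantCoeff_eq_zero_of_mem_maximalIdeal (hframe ▸ Ideal.subset_span hg)
  have hx0 : constantCoeff x = 0 := hmem x (by simp)
  have hv0 : constantCoeff v = 0 := hmem v (by simp)
  have hXi : ∀ i : Fin 3, (X i : MvPowerSeries (Fin 3) K) ∈ Ideal.span {x, v, y} := fun i =>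
    hframe ▸ mem_maximalIdeal_of_constantCoeff_eq_zero (constantCoeff_X i)
  rw [mem_flagContactFiltration_X_iff hadm] at hreach ⊢
  exact rowB_core_anyFrame' p hpd hlt hN₁ hN₂ hN₃ hq hqr hΛ hx0 hv0 (hmem y (by simp)) (hXi 0) (hXi 1)
    (coeff_faceTail_nsmul_single p hN₁ (hqr.trans hr₂r₁) hr₂r₁ J γ c b hJ hx0 hv0)
    (fun a hWv ha => lt_weightedOrder_faceTail hqr hr₂r₁.le hN₂ J γ c b hJ hx0 a hWv ha)
    (fun a ρ hWG hWR ha haρ hρ =>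
      lt_weightedOrder_faceTail_sub_pClassComponent p hqr hr₂r₁.le hN₂ J γ c b hJ hx0 a ρ hWG hWR ha haρ hρ)
    hreach

/-- **ROW B, ALL SUB-FACE TAILS, EVERY COMPETING FLAG** [OURS · L1 W4.3 · (F-3g)].  For a field `K` of
characteristic `p` and the germ `f = X₂^p + Λ X₁^d + Σ_j γ_j X₀^{c_j} X₁^{b_j} + X₀^M` (`p ∤ d`, `p < d`, `Λ ≠ 0`,
`N = p r₁ = d r₂ = M q`, `0 < q < r₂`; mixed terms on the face `q c_j + r₂ b_j = N` with `1 ≤ b_j < d`, and `p ∣ c_j`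
for the `b_j = d − 1` terms): every two-flag `(y'; v')` with `f ∈ F_{(y';v')}^{(q;r₁,r₂)}(N)` has
`X₁ ∈ F_{(y';v')}^{(q;r₁,r₂)}(r₂)`.  The only germs of the shape «`y^p + Λv^d +` face terms» NOT covered are those
with a `b = d − 1` term `x^c v^{d−1}`, `p ∤ c` (brk-1's `x⁵v²`, `p = 2`): the genuine Row-B balance. -/
theorem rowB_secondMember_mem_of_isTwoFlag (p : ℕ) [Fact p.Prime] {K : Type*} [Field K] [CharP K p]
    (d M q r₁ r₂ N : ℕ) (hpd : ¬ p ∣ d) (hlt : p < d) (hN₁ : p * r₁ = N) (hN₂ : d * r₂ = N) (hN₃ : M * q = N)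
    (hq : 0 < q) (hqr : q < r₂) (Λ : K) (hΛ : Λ ≠ 0) {ι : Type*} (J : Finset ι) (γ : ι → K) (c b : ι → ℕ)
    (hJ : ∀ j ∈ J, 1 ≤ b j ∧ b j < d ∧ q * c j + r₂ * b j = N ∧ (b j + 1 = d → p ∣ c j))
    (y' v' : MvPowerSeries (Fin 3) K) (hflag : IsTwoFlag y' v')
    (hreach : (X 2 : MvPowerSeries (Fin 3) K) ^ p + C Λ * X 1 ^ d +
        (∑ j ∈ J, C (γ j) * ((X 0 : MvPowerSeries (Fin 3) K) ^ c j * X 1 ^ b j)) + X 0 ^ M ∈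
      flagContactFiltration y' v' q r₁ r₂ N) :
    (X 1 : MvPowerSeries (Fin 3) K) ∈ flagContactFiltration y' v' q r₁ r₂ r₂ := by
  obtain ⟨i, hdet⟩ := exists_isUnit_det_of_isTwoFlag hflag
  set θ : Fin 3 → MvPowerSeries (Fin 3) K := ![(X i : MvPowerSeries (Fin 3) K), v', y'] with hθ
  have hv0 : constantCoeff v' = 0 := constantCoeff_eq_zero_of_mem_maximalIdeal hflag.2.1
  have hy0 : constantCoeff y' = 0 := constantCoeff_eq_zero_of_mem_maximalIdeal hflag.1
  have h0 : ∀ j, constantCoeff (θ j) = 0 := by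
    intro j; fin_cases j
    · exact constantCoeff_X i
    · exact hv0
    · exact hy0
  have hθs : HasSubst θ := hasSubst_of_constantCoeff_zero h0
  obtain ⟨e, he⟩ := exists_ringEquiv_subst h0 hdet
  have he1 : e (X 1) = v' := by rw [he, subst_X hθs]; rfl
  have he2 : e (X 2) = y' := by rw [he, subst_X hθs]; rfl
  have heC : ∀ a : K, e (C a) = C a := fun a => by rw [he, subst_C]
  set ψ := e.symm with hψ
  have hψv : ψ v' = X 1 := by rw [hψ, RingEquiv.symm_apply_eq, he1]
  have hψy : ψ y' = X 2 := by rw [hψ, RingEquiv.symm_apply_eq, he2]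
  have hψC : ∀ a : K, ψ (C a) = C a := fun a => by rw [hψ, RingEquiv.symm_apply_eq, heC]
  have hψsum : ψ (∑ j ∈ J, C (γ j) * ((X 0 : MvPowerSeries (Fin 3) K) ^ c j * X 1 ^ b j)) =
      ∑ j ∈ J, C (γ j) * (ψ (X 0) ^ c j * ψ (X 1) ^ b j) := by
    rw [map_sum]
    refine Finset.sum_congr rfl fun j _ => ?_
    rw [map_mul, map_mul, map_pow, map_pow, hψC]
  have hreach' : (ψ (X 2)) ^ p + C Λ * (ψ (X 1)) ^ d + (∑ j ∈ J, C (γ j) * (ψ (X 0) ^ c j * ψ (X 1) ^ b j)) +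
      (ψ (X 0)) ^ M ∈ flagContactFiltration (X 2 : MvPowerSeries (Fin 3) K) (X 1) q r₁ r₂ N := by
    have h := (apply_mem_flagContactFiltration_iff ψ ((X 2 : MvPowerSeries (Fin 3) K) ^ p + C Λ * X 1 ^ d +
      (∑ j ∈ J, C (γ j) * ((X 0 : MvPowerSeries (Fin 3) K) ^ c j * X 1 ^ b j)) + X 0 ^ M) y' v' q r₁ r₂ N).mpr hreach
    rwa [hψy, hψv, map_add, map_add, map_add, map_pow, map_mul, map_pow, map_pow, hψC, hψsum] at h
  have hframe' : Ideal.span {ψ (X 0), ψ (X 1), ψ (X 2)} = maximalIdeal (MvPowerSeries (Fin 3) K) := by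
    rw [← map_ringEquiv_maximalIdeal ψ, maximalIdeal_eq_span_triple, Ideal.map_span, Set.image_insert_eq,
      Set.image_insert_eq, Set.image_singleton]
  have h := rowB_secondMember_mem_anyFrame p d M q r₁ r₂ N hpd hlt hN₁ hN₂ hN₃ hq hqr Λ hΛ J γ c b hJ
    (ψ (X 0)) (ψ (X 2)) (ψ (X 1)) hframe' hreach'
  have h' := apply_mem_flagContactFiltration_iff ψ (X 1 : MvPowerSeries (Fin 3) K) y' v' q r₁ r₂ r₂
  rw [hψy, hψv] at h'
  exact h'.mp h

end Summit.ResolutionOfSingularities.ResolutionOfSingularities.Theorems.LocalEngine.Iota3.RowA
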